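import Mathlib
import Summits.MatrixMultiplication.MatrixMultiplication.Theorems.SnSubsetDichotomyNoThresholdSubsetTripleFreedman

/-!
# The (Q)-lemma, measure-theoretic half, two-process form: the Freedman bound on one band

Stub `stub_lyapunov_band_two` for line `klr-graded-polynomial-method` of crux
`stmt-MatrixMultiplication-8302`. Let `V_t ≥ 0` (a Lyapunov functional, `V_0 = 0`) and `q_t ≥ 0`
be adapted to a filtration `ℱ` on a probability space, with the one-step hypotheses
(L1) `μ[V_{t+1} − V_t | ℱ t] ≤ K − c q_t/√n`, (L2) `|V_{t+1} − V_t| ≤ b√n`,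
(L3) `μ[(V_{t+1} − V_t)² | ℱ t] ≤ C (q_t + 1)`.
Then the time-sum `S = Σ_{t<n} q_t` satisfies, on every band `{L ≤ S ≤ 2L}`, the Freedman bound
with `x = cL/√n − Kn`, `v = C(2L + n)` and increment bound `2b√n`. The special case `V = q` is
`stub_lyapunov_band` (file `…LyapunovBand.lean`); the proof is the same, with the martingale built
from `V` and the band/drift bounds expressed through `q`.

Proof (Doob decomposition + Freedman's inequality `stub_freedman_exp`): with
`Δ_t = V_{t+1} − V_t`, `E_t = μ[Δ_t | ℱ t]` and its truncation
`T_t = max (−b√n) (min (b√n) E_t)` (equal to `E_t` a.e. since `|E_t| ≤ b√n` a.e., but bounded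
everywhere, which Freedman's pointwise hypothesis needs), `D_{t+1} = Δ_t − T_t` (`D_0 = 0`) are
martingale differences bounded by `2b√n`, with `μ[D_{t+1}² | ℱ t] = Var[Δ_t | ℱ t] ≤ μ[Δ_t² | ℱ t]`
a.e.  Off a null set, on the band, `Σ_{t<n} D_{t+1} = V_n − Σ E_t ≥ cS/√n − Kn ≥ x` (telescoping,
(L1), `V_n ≥ 0`, `V_0 = 0`, `c ≥ 0`, `S ≥ L`) and
`Σ_{t<n} μ[D_{t+1}² | ℱ t] ≤ Σ C(q_t + 1) = C(S + n) ≤ v` ((L3), `C ≥ 0`, `S ≤ 2L`), so the band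
lies a.e. inside the Freedman event [Freedman 1975, Thm 1.6]. The dyadic peeling over bands is
NOT here (stub `stub_dyadic_peel`).
-/

open MeasureTheory ProbabilityTheory
open scoped BigOperators

namespace Summit.MatrixMultiplication.MatrixMultiplication.Theorems

set_option linter.dupNamespace false in
/-- Real-valued monotonicity of a finite measure along an a.e. inclusion: if `s ⊆ t` off a `μ`-null
set then `μ.real s ≤ μ.real t`. [folklore] -/
private theorem band2_measureReal_mono_ae {Ω : Type*} [MeasurableSpace Ω] {μ : Measure Ω}
    [IsFiniteMeasure μ] {s t : Set Ω} (h : ∀ᵐ ω ∂μ, ω ∈ s → ω ∈ t) : μ.real s ≤ μ.real t := by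
  simp only [measureReal_def]
  exact ENNReal.toReal_mono (measure_ne_top _ _) (measure_mono_ae h)

set_option linter.dupNamespace false in
/-- The truncation at level `B ≥ 0` is bounded by `B`: `|max (-B) (min B x)| ≤ B`. [folklore] -/
private theorem band2_abs_trunc_le {B : ℝ} (hB : 0 ≤ B) (x : ℝ) : |max (-B) (min B x)| ≤ B :=
  abs_le.2 ⟨le_max_left _ _, max_le (by linarith) (min_le_left _ _)⟩

set_option linter.dupNamespace false in
/-- The truncation at level `B` does nothing to `x` when `|x| ≤ B`. [folklore] -/
private theorem band2_trunc_eq_self {B x : ℝ} (h : |x| ≤ B) : max (-B) (min B x) = x := by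
  obtain ⟨h1, h2⟩ := abs_le.1 h
  rw [min_eq_right h2, max_eq_right h1]

set_option linter.dupNamespace false in
/-- The truncation of a strongly measurable real function is strongly measurable (composition
with the continuous map `x ↦ max (-B) (min B x)`). [folklore] -/
private theorem band2_stronglyMeasurable_trunc {Ω : Type*} {m : MeasurableSpace Ω} (B : ℝ)
    {f : Ω → ℝ} (hf : StronglyMeasurable[m] f) :
    StronglyMeasurable[m] (fun ω => max (-B) (min B (f ω))) := by
  have hg : Continuous fun x : ℝ => max (-B) (min B x) :=
    continuous_const.max (continuous_const.min continuous_id)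
  exact hg.comp_stronglyMeasurable hf

set_option linter.dupNamespace false in
/-- The conditional expectation of a function bounded by `B` is bounded by `B` a.e.
(`ae_bdd_abs_condExp_of_ae_bdd_abs`), hence its truncation at level `B` equals it a.e.
[folklore] -/
private theorem band2_trunc_condExp_ae_eq {Ω : Type*} {m mΩ : MeasurableSpace Ω} {μ : Measure Ω}
    {X : Ω → ℝ} {B : ℝ} (hXbdd : ∀ ω, |X ω| ≤ B) :
    ∀ᵐ ω ∂μ, max (-B) (min B ((μ[X | m]) ω)) = (μ[X | m]) ω := by
  filter_upwards [ae_bdd_abs_condExp_of_ae_bdd_abs (m := m) (ae_of_all μ hXbdd)] with ω hω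
  exact band2_trunc_eq_self hω

set_option linter.dupNamespace false in
/-- **Centering.** If `Y` is an `m`-measurable integrable version of `μ[X | m]` (equal to it a.e.),
then `X - Y` is conditionally centred: `μ[X - Y | m] = μ[X | m] - Y = 0` a.e. [folklore] -/
private theorem band2_condExp_sub_ae_eq_zero {Ω : Type*} {m mΩ : MeasurableSpace Ω}
    {μ : Measure Ω} [IsFiniteMeasure μ] (hm : m ≤ mΩ) {X Y : Ω → ℝ} (hX : Integrable X μ)
    (hYm : StronglyMeasurable[m] Y) (hY : Integrable Y μ)
    (hYE : ∀ᵐ ω ∂μ, Y ω = (μ[X | m]) ω) :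
    μ[fun ω => X ω - Y ω | m] =ᵐ[μ] 0 := by
  have hsub : μ[X - Y | m] =ᵐ[μ] μ[X | m] - μ[Y | m] := condExp_sub hX hY m
  have hYY : μ[Y | m] = Y := condExp_of_stronglyMeasurable hm hYm hY
  change μ[X - Y | m] =ᵐ[μ] 0
  filter_upwards [hsub, hYE] with ω h1 h2
  rw [h1, Pi.sub_apply, hYY, h2, Pi.zero_apply, sub_self]

set_option linter.dupNamespace false in
/-- **Conditional variance.** If `Y = μ[X | m]` a.e. and `X ∈ L²`, then
`μ[(X - Y)² | m] = Var[X | m] ≤ μ[X² | m]` a.e. (`ProbabilityTheory.condVar_ae_le_condExp_sq`).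
[folklore] -/
private theorem band2_condExp_sq_sub_ae_le {Ω : Type*} {m mΩ : MeasurableSpace Ω} {μ : Measure Ω}
    [IsFiniteMeasure μ] (hm : m ≤ mΩ) {X Y : Ω → ℝ} (hX : MemLp X 2 μ)
    (hYE : ∀ᵐ ω ∂μ, Y ω = (μ[X | m]) ω) :
    μ[fun ω => (X ω - Y ω) ^ 2 | m] ≤ᵐ[μ] μ[fun ω => X ω ^ 2 | m] := by
  have hae : (fun ω => (X ω - Y ω) ^ 2) =ᵐ[μ] (X - μ[X | m]) ^ 2 := by
    filter_upwards [hYE] with ω hω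
    rw [Pi.pow_apply, Pi.sub_apply, hω]
  have h1 : μ[fun ω => (X ω - Y ω) ^ 2 | m] =ᵐ[μ] Var[X; μ | m] := condExp_congr_ae hae
  have h2 : Var[X; μ | m] ≤ᵐ[μ] μ[X ^ 2 | m] := condVar_ae_le_condExp_sq hm hX
  exact h1.trans_le h2

set_option linter.dupNamespace false in
/-- **(Q)-lemma, measure-theoretic half (one band), two-process form.** Let `V_t ≥ 0` (`V_0 = 0`)
and `q_t ≥ 0` be adapted to the filtration `ℱ` on a probability space, with (L1) drift
`μ[V_{t+1} − V_t | ℱ t] ≤ K − c q_t/√n` a.e., (L2) bounded increments `|V_{t+1} − V_t| ≤ b√n`,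
(L3) conditional second moment `μ[(V_{t+1} − V_t)² | ℱ t] ≤ C(q_t + 1)` a.e. (`c, C ≥ 0`, `b > 0`,
`n ≥ 1`). Then for `S = Σ_{t<n} q_t`, every `L` and every `λ ≥ 0`,
`μ {L ≤ S ≤ 2L} ≤ exp (−λ (cL/√n − Kn) + C(2L + n) · (e^{2λb√n} − 1 − 2λb√n)/(2b√n)²)`.
Proof: the compensated increments `D_{t+1} = (V_{t+1} − V_t) − T_t`, `T_t` the truncation at level
`b√n` of `μ[V_{t+1} − V_t | ℱ t]` (a.e. equal to it), are martingale differences bounded by `2b√n`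
with `μ[D_{t+1}² | ℱ t] ≤ μ[(V_{t+1} − V_t)² | ℱ t]` a.e.; off a null set the band lies in the event
`{cL/√n − Kn ≤ Σ D_{t+1}, Σ μ[D_{t+1}² | ℱ t] ≤ C(2L + n)}` (telescoping `Σ (V_{t+1} − V_t) =
V_n − V_0 = V_n ≥ 0` + (L1) summed, resp. (L3) summed), whose measure `stub_freedman_exp` bounds.
The special case `V = q` is `stub_lyapunov_band`. [lead c7 report §2a; Freedman 1975, Thm 1.6] -/
theorem stub_lyapunov_band_two {Ω : Type*} {mΩ : MeasurableSpace Ω} {μ : Measure Ω} [IsProbabilityMeasure μ]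
    (ℱ : Filtration ℕ mΩ) (V q : ℕ → Ω → ℝ) (n : ℕ) (hn : 0 < n) (K c b C : ℝ) (hc : 0 ≤ c) (hb : 0 < b) (hC : 0 ≤ C)
    (hV_meas : ∀ t, StronglyMeasurable[ℱ t] (V t)) (hq_meas : ∀ t, StronglyMeasurable[ℱ t] (q t))
    (hV_nonneg : ∀ t ω, 0 ≤ V t ω) (hq_nonneg : ∀ t ω, 0 ≤ q t ω) (hV0 : ∀ ω, V 0 ω = 0)
    (hL1 : ∀ t, μ[fun ω => V (t + 1) ω - V t ω | ℱ t] ≤ᵐ[μ] fun ω => K - c * q t ω / Real.sqrt n)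
    (hL2 : ∀ t ω, |V (t + 1) ω - V t ω| ≤ b * Real.sqrt n)
    (hL3 : ∀ t, μ[fun ω => (V (t + 1) ω - V t ω) ^ 2 | ℱ t] ≤ᵐ[μ] fun ω => C * (q t ω + 1))
    (L lam : ℝ) (hlam : 0 ≤ lam) :
    μ.real {ω | L ≤ ∑ t ∈ Finset.range n, q t ω ∧ ∑ t ∈ Finset.range n, q t ω ≤ 2 * L} ≤
      Real.exp (-(lam * (c * L / Real.sqrt n - K * n)) +
        C * (2 * L + n) * ((Real.exp (lam * (2 * b * Real.sqrt n)) - 1 - lam * (2 * b * Real.sqrt n)) /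
          (2 * b * Real.sqrt n) ^ 2)) := by
  -- `q` enters only through the a.e. bounds (L1), (L3) and the band event; its adaptedness and
  -- nonnegativity are part of the registered interface but not needed below.
  have _hq_meas := hq_meas
  have _hq_nonneg := hq_nonneg
  set sn : ℝ := Real.sqrt n with hsn_def
  have hsn : 0 < sn := Real.sqrt_pos.2 (Nat.cast_pos.2 hn)
  have hB : 0 ≤ b * sn := by positivity
  have h2b : 0 < 2 * b * sn := by positivity
  -- the increments `Δ_t = V (t+1) - V t`: measurability and integrability
  have hΔm : ∀ t, StronglyMeasurable[ℱ (t + 1)] (fun ω => V (t + 1) ω - V t ω) := fun t =>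
    (hV_meas (t + 1)).sub ((hV_meas t).mono (ℱ.mono (Nat.le_succ t)))
  have hΔae : ∀ t, AEStronglyMeasurable (fun ω => V (t + 1) ω - V t ω) μ := fun t =>
    ((hΔm t).mono (ℱ.le (t + 1))).aestronglyMeasurable
  have hΔint : ∀ t, Integrable (fun ω => V (t + 1) ω - V t ω) μ := fun t =>
    Integrable.of_bound (hΔae t) (b * sn) (ae_of_all _ fun ω => by
      rw [Real.norm_eq_abs]; exact hL2 t ω)
  have hΔL2 : ∀ t, MemLp (fun ω => V (t + 1) ω - V t ω) 2 μ := fun t =>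
    MemLp.of_bound (hΔae t) (b * sn) (ae_of_all _ fun ω => by
      rw [Real.norm_eq_abs]; exact hL2 t ω)
  -- the truncated conditional means `T_t` of the increments
  obtain ⟨T, hT⟩ : ∃ T : ℕ → Ω → ℝ, ∀ t, T t = fun ω =>
      max (-(b * sn)) (min (b * sn) ((μ[fun ω' => V (t + 1) ω' - V t ω' | ℱ t]) ω)) :=
    ⟨_, fun _ => rfl⟩
  have hTm : ∀ t, StronglyMeasurable[ℱ t] (T t) := fun t => by
    rw [hT t]
    exact band2_stronglyMeasurable_trunc _ stronglyMeasurable_condExp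
  have hTbdd : ∀ t ω, |T t ω| ≤ b * sn := fun t ω => by
    rw [hT t]
    exact band2_abs_trunc_le hB _
  have hTint : ∀ t, Integrable (T t) μ := fun t =>
    Integrable.of_bound ((hTm t).mono (ℱ.le t)).aestronglyMeasurable (b * sn)
      (ae_of_all _ fun ω => by rw [Real.norm_eq_abs]; exact hTbdd t ω)
  have hTE : ∀ t, ∀ᵐ ω ∂μ, T t ω = (μ[fun ω' => V (t + 1) ω' - V t ω' | ℱ t]) ω := fun t => by
    rw [hT t]
    exact band2_trunc_condExp_ae_eq (hL2 t)
  -- the martingale differences `D (t+1) = Δ_t - T_t`, `D 0 = 0`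
  obtain ⟨D, hD0, hDsucc⟩ : ∃ D : ℕ → Ω → ℝ, D 0 = (fun _ => 0) ∧
      ∀ t, D (t + 1) = fun ω => V (t + 1) ω - V t ω - T t ω :=
    ⟨fun i => match i with
      | 0 => fun _ => 0
      | t + 1 => fun ω => V (t + 1) ω - V t ω - T t ω, rfl, fun _ => rfl⟩
  have hDmeas : ∀ i, StronglyMeasurable[ℱ i] (D i) := by
    intro i
    cases i with
    | zero => rw [hD0]; exact stronglyMeasurable_const
    | succ t => rw [hDsucc]; exact (hΔm t).sub ((hTm t).mono (ℱ.mono (Nat.le_succ t)))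
  have hDbdd : ∀ i ω, |D i ω| ≤ 2 * b * sn := by
    intro i ω
    cases i with
    | zero =>
      rw [hD0]
      show |(0 : ℝ)| ≤ 2 * b * sn
      rw [abs_zero]
      exact h2b.le
    | succ t =>
      rw [hDsucc]
      show |V (t + 1) ω - V t ω - T t ω| ≤ 2 * b * sn
      have h1 := abs_le.1 (hL2 t ω)
      have h2 := abs_le.1 (hTbdd t ω)
      exact abs_le.2 ⟨by linarith [h1.1, h2.2], by linarith [h1.2, h2.1]⟩
  have hDmds : ∀ i, μ[D (i + 1) | ℱ i] =ᵐ[μ] 0 := fun t => by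
    rw [hDsucc]
    exact band2_condExp_sub_ae_eq_zero (ℱ.le t) (hΔint t) (hTm t) (hTint t) (hTE t)
  -- Freedman's inequality for `D` with increment bound `2b√n`
  have hF := stub_freedman_exp ℱ D (2 * b * sn) h2b hDmeas hDbdd hDmds n
    (c * L / sn - K * n) (C * (2 * L + n)) lam hlam
  refine le_trans (band2_measureReal_mono_ae ?_) hF
  -- the a.e. facts, simultaneously for all `t`
  have h1 : ∀ᵐ ω ∂μ, ∀ t, (μ[fun ω' => V (t + 1) ω' - V t ω' | ℱ t]) ω ≤ K - c * q t ω / sn :=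
    ae_all_iff.2 fun t => hL1 t
  have h3 : ∀ᵐ ω ∂μ, ∀ t,
      (μ[fun ω' => (V (t + 1) ω' - V t ω') ^ 2 | ℱ t]) ω ≤ C * (q t ω + 1) :=
    ae_all_iff.2 fun t => hL3 t
  have hTE' : ∀ᵐ ω ∂μ, ∀ t, T t ω = (μ[fun ω' => V (t + 1) ω' - V t ω' | ℱ t]) ω :=
    ae_all_iff.2 hTE
  have hV : ∀ᵐ ω ∂μ, ∀ t, (μ[fun ω' => D (t + 1) ω' ^ 2 | ℱ t]) ω ≤
      (μ[fun ω' => (V (t + 1) ω' - V t ω') ^ 2 | ℱ t]) ω := by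
    refine ae_all_iff.2 fun t => ?_
    have h := band2_condExp_sq_sub_ae_le (ℱ.le t) (hΔL2 t) (hTE t)
    rw [hDsucc]
    exact h
  filter_upwards [h1, h3, hTE', hV] with ω h1ω h3ω hTω hVω hband
  obtain ⟨hLS, hS2L⟩ := hband
  have hDω : ∀ i, D (i + 1) ω =
      V (i + 1) ω - V i ω - (μ[fun ω' => V (i + 1) ω' - V i ω' | ℱ i]) ω := by
    intro i
    rw [hDsucc, ← hTω i]
  refine ⟨?_, ?_⟩
  · -- `x ≤ Σ D (i+1)`: telescoping, (L1), `V n ≥ 0`, `V 0 = 0`, `S ≥ L`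
    have htel : ∑ i ∈ Finset.range n, (V (i + 1) ω - V i ω) = V n ω - V 0 ω :=
      Finset.sum_range_sub (fun i => V i ω) n
    have hsum : ∑ i ∈ Finset.range n, D (i + 1) ω =
        V n ω - ∑ i ∈ Finset.range n, (μ[fun ω' => V (i + 1) ω' - V i ω' | ℱ i]) ω := by
      rw [Finset.sum_congr rfl fun i _ => hDω i, Finset.sum_sub_distrib, htel, hV0, sub_zero]
    have hEsum : ∑ i ∈ Finset.range n, (μ[fun ω' => V (i + 1) ω' - V i ω' | ℱ i]) ω ≤
        ∑ i ∈ Finset.range n, (K - c * q i ω / sn) := Finset.sum_le_sum fun i _ => h1ω i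
    have hKsum : ∑ i ∈ Finset.range n, (K - c * q i ω / sn) =
        K * n - c * (∑ i ∈ Finset.range n, q i ω) / sn := by
      rw [Finset.sum_sub_distrib, Finset.sum_const, Finset.card_range, nsmul_eq_mul,
        Finset.mul_sum, Finset.sum_div]
      ring
    have hcL : c * L / sn ≤ c * (∑ i ∈ Finset.range n, q i ω) / sn :=
      div_le_div_of_nonneg_right (mul_le_mul_of_nonneg_left hLS hc) hsn.le
    have hVn := hV_nonneg n ω
    rw [hsum]
    linarith
  · -- `Σ μ[D (i+1)² | ℱ i] ≤ v`: conditional variance ≤ conditional second moment, (L3), `S ≤ 2L`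
    calc ∑ i ∈ Finset.range n, (μ[fun ω' => D (i + 1) ω' ^ 2 | ℱ i]) ω
        ≤ ∑ i ∈ Finset.range n, (μ[fun ω' => (V (i + 1) ω' - V i ω') ^ 2 | ℱ i]) ω :=
          Finset.sum_le_sum fun i _ => hVω i
      _ ≤ ∑ i ∈ Finset.range n, C * (q i ω + 1) := Finset.sum_le_sum fun i _ => h3ω i
      _ = C * (∑ i ∈ Finset.range n, q i ω + n) := by
          rw [← Finset.mul_sum, Finset.sum_add_distrib, Finset.sum_const, Finset.card_range,
            nsmul_eq_mul, mul_one]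
      _ ≤ C * (2 * L + n) := mul_le_mul_of_nonneg_left (by linarith) hC

end Summit.MatrixMultiplication.MatrixMultiplication.Theorems
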